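import Summits.BirchSwinnertonDyer.Rank1Residual.ManinAdditive.ConwayNortonTwistAtThree
import Summits.BirchSwinnertonDyer.BirchSwinnertonDyer.Theorems.ManinLocalTwoThreeTranslationNormalizer
import Summits.BirchSwinnertonDyer.Rank1Residual.O5.CharTwistThreeIsometry
import Literature.NumberTheory.EllipticCurves.NewformGaloisRepIntegralityProofs
import Literature.NumberTheory.EllipticCurves.CuspFormLFunction
import HarnessLib
import HarnessLib.Audit.Tags

/-!
# E-desc-51′ `TwistOperatorEqCharTwist` IS A THEOREM: `B₃ f = f ⊗ χ₋₃` on `S₂(Γ₀(N))`, `9 ∣ N`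
# (cell `bsd-f2-manin`, desc g8 support target; refuter-1 §R64 R-2 «land first»; typer g12)

Summit `BirchSwinnertonDyer`, sub-problem `Rank1Residual`, leaf family `ManinAdditive` (statement file
`ConwayNortonTwistAtThree.lean`, p636155).  PROVED here, sorry-free:

* `thirdTranslate_two_apply` — `(t_{j/3} f)(τ) = f(τ + j/3)` at weight `2`, `9 ∣ N` (one-coset double coset of a
  normalising element, exactly as the lead's `ramanujanThree_two_apply`);
* `cuspCoeff_thirdTranslate_two` — `aₙ(t_{j/3} f) = ζ₃^{jn} aₙ(f)`, `ζ₃ = e^{2πi/3}` (`q`-expansion uniqueness);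
* `cuspCoeff_twistOperatorAtThree_two` — `aₙ(B₃ f) = χ(n) aₙ(f)` for THE primitive quadratic character `χ` mod `3`
  (`(ζ₃ⁿ − ζ₃²ⁿ)/(ζ₃ − ζ₃²) = χ₋₃(n)`, refuter-1 RB72.5; `χ(2) = −1` is O5's `chi_three_apply_two`);
* **`twistOperatorEqCharTwist_holds : TwistOperatorEqCharTwist`** — by the `q`-expansion principle
  (`eq_of_forall_cuspCoeff_eq_gamma0`) against `cuspCoeff_charTwist`.

Elementary `q`-expansion bookkeeping (Atkin–Lehner 1970 §4; Shimura 1971 Prop. 3.64); nothing about BSD or Manin's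
conjecture is proved by this.  It is the normalisation test refuter-1 asked for before E-desc-54 / E-desc-52 are attempted.
-/

set_option autoImplicit false

noncomputable section

open scoped MatrixGroups ModularForm Real

open CongruenceSubgroup Matrix.SpecialLinearGroup UpperHalfPlane Complex Matrix.GeneralLinearGroup
  Literature.NumberTheory.EllipticCurves.ModularForms
  Summit.BirchSwinnertonDyer.Rank1Residual.ManinAdditive.RamanujanCut
  Summit.BirchSwinnertonDyer.BirchSwinnertonDyer.Theorems.ManinLocalTwoThree

namespace Summit.BirchSwinnertonDyer.Rank1Residual.ManinAdditive.ConwayNortonThree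

variable {N : ℕ} [NeZero N]

/-- `(h j; 0 h) = diag(h, 1) · diag(1, h) · (1 j/h; 0 1)` in `GL(2, ℝ)` (local copy of the lead's private lemma).
[folklore] -/
private theorem glCast_eq_tpD_mul_tpG_mul_upperRightHom' {g : GL (Fin 2) ℚ} (h : ℕ) [NeZero h] (j : ℤ)
    (hg : ((glCast g : GL (Fin 2) ℝ) : Matrix (Fin 2) (Fin 2) ℝ) = !![((h : ℤ) : ℝ), (j : ℝ); 0, ((h : ℤ) : ℝ)]) :
    glCast g = tpD h * tpG h * upperRightHom ((j : ℝ) / h) := by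
  have hh : (h : ℝ) ≠ 0 := by exact_mod_cast NeZero.ne h
  ext i j'
  rw [hg]
  simp only [Units.val_mul, Matrix.mul_apply, Fin.sum_univ_two, val_tpD, val_tpG]
  fin_cases i <;> fin_cases j' <;> simp [upperRightHom_apply, mul_div_cancel₀, hh]

/-- `(f ∣₂ (h j; 0 h))(τ) = f(τ + j/h)` (weight `2`; local copy of the lead's private lemma). [folklore] -/
private theorem slash_two_upper_apply' {g : GL (Fin 2) ℚ} (h : ℕ) [NeZero h] (j : ℤ)
    (hg : ((glCast g : GL (Fin 2) ℝ) : Matrix (Fin 2) (Fin 2) ℝ) = !![((h : ℤ) : ℝ), (j : ℝ); 0, ((h : ℤ) : ℝ)])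
    (f : ℍ → ℂ) (τ : ℍ) :
    (f ∣[(2 : ℤ)] glCast g) τ = f (((j : ℝ) / h) +ᵥ τ) := by
  rw [glCast_eq_tpD_mul_tpG_mul_upperRightHom' h j hg, SlashAction.slash_mul, slash_tpD_mul_tpG h 2 f,
    sub_self, zpow_zero, one_smul, slash_upperRightHom_apply]

/-- **One-term formula for `t_{j/3}`** (`9 ∣ N`): `t_{j/3} f = 9^{1−k/2} • (f ∣[k] (3 j; 0 3))` as functions on `ℍ`.
[cite: AtkinLehner1970, Lemma 27] -/
theorem coe_thirdTranslate_eq_slash (h9 : 9 ∣ N) {k : ℤ} (j : ℕ) (f : CuspForm (Gamma0 N) k) :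
    (⇑(thirdTranslate N k j f) : ℍ → ℂ) =
      (((9 : ℝ) ^ (1 - (k : ℝ) / 2) : ℝ) : ℂ) • (⇑f ∣[k] glCast (thirdTranslateGL j : GL (Fin 2) ℚ)) := by
  have h1 := coe_cuspHeckeCorrespondence_eq_sum (Gamma0 N) (Gamma0 N) k (thirdTranslateGL j : GL (Fin 2) ℚ)
    (isDoubleCosetDecomp_of_normalises fun x hx ↦ thirdTranslateGL_mul_mul_inv_mem h9 j hx) f
  rw [Fintype.sum_unique] at h1
  unfold thirdTranslate
  rw [LinearMap.smul_apply, CuspForm.IsGLPos.coe_smul]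
  congr 1

/-- **`(t_{j/3} f)(τ) = f(τ + j/3)`** at weight `2`, `9 ∣ N`. [cite: AtkinLehner1970, §4] -/
theorem thirdTranslate_two_apply (h9 : 9 ∣ N) (j : ℕ) (f : CuspForm (Gamma0 N) 2) (τ : ℍ) :
    thirdTranslate N 2 j f τ = f ((((j : ℤ) : ℝ) / (3 : ℕ)) +ᵥ τ) := by
  have h := congrFun (coe_thirdTranslate_eq_slash h9 j f) τ
  rw [Pi.smul_apply, slash_two_upper_apply' 3 (j : ℤ) (val_glCast_thirdTranslateGL j), smul_eq_mul] at h
  rw [h]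
  norm_num

/-- `ζ₃ := zeta3 = e^{2πi/3}` is a primitive cube root of unity. [folklore] -/
theorem isPrimitiveRoot_zeta3 : IsPrimitiveRoot zeta3 3 := by
  have h := Complex.isPrimitiveRoot_exp 3 (by norm_num)
  convert h using 2
  simp [zeta3]

/-- `e^{2πi·(j/3)} = ζ₃^j`. [folklore] -/
theorem exp_two_pi_I_third_mul (j : ℕ) :
    cexp (2 * π * Complex.I * ((((j : ℤ) : ℝ) / (3 : ℕ) : ℝ) : ℂ)) = zeta3 ^ j := by
  rw [zeta3, ← Complex.exp_nat_mul]
  congr 1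
  push_cast
  ring

/-- **`aₙ(t_{j/3} f) = ζ₃^{jn} aₙ(f)`** (`9 ∣ N`, weight `2`). [cite: DiamondShurman2005, §1.1 and §5.8] -/
theorem cuspCoeff_thirdTranslate_two (h9 : 9 ∣ N) (j : ℕ) (f : CuspForm (Gamma0 N) 2) (n : ℕ) :
    cuspCoeff (thirdTranslate N 2 j f) n = (zeta3 ^ j) ^ n * cuspCoeff f n := by
  have hΓ : (1 : ℝ) ∈ (Gamma0 N : Subgroup (GL (Fin 2) ℝ)).strictPeriods :=
    strictWidthInfty_Gamma0 N ▸ Subgroup.strictWidthInfty_mem_strictPeriods _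
  haveI : Fact (IsCusp OnePoint.infty (Gamma0 N : Subgroup (GL (Fin 2) ℝ))) :=
    ⟨Subgroup.isCusp_of_mem_strictPeriods one_pos hΓ⟩
  have hsum : ∀ τ : ℍ, HasSum (fun m : ℕ ↦ ((zeta3 ^ j) ^ m * cuspCoeff f m) •
      Function.Periodic.qParam 1 (τ : ℂ) ^ m) (thirdTranslate N 2 j f τ) := by
    intro τ
    have h := UpperHalfPlane.hasSum_qExpansion one_pos
      (SlashInvariantFormClass.periodic_comp_ofComplex f hΓ) (ModularFormClass.holo f)
      (ModularFormClass.bdd_at_infty f) (((((j : ℤ) : ℝ) / (3 : ℕ) : ℝ)) +ᵥ τ)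
    rw [thirdTranslate_two_apply h9]
    convert h using 2 with m
    rw [qParam_vadd, exp_two_pi_I_third_mul, mul_pow, smul_eq_mul, smul_eq_mul, cuspCoeff]
    ring
  rw [cuspCoeff, ← ModularFormClass.qExpansion_coeff_unique one_pos hΓ hsum n]

/-- The RB72.5 identity: `(ζ₃ⁿ − ζ₃²ⁿ)/(ζ₃ − ζ₃²) = χ₋₃(n)` for THE primitive quadratic character mod `3`.
[folklore] -/
theorem zeta3_pow_sub_div_eq_chi {χ : DirichletCharacter ℂ 3} (hχ : χ.IsQuadratic) (hprim : χ.IsPrimitive)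
    (n : ℕ) :
    (zeta3 - zeta3 ^ 2)⁻¹ * ((zeta3 ^ 1) ^ n - (zeta3 ^ 2) ^ n) = χ (n : ZMod 3) := by
  have hζ := isPrimitiveRoot_zeta3
  have h3 : zeta3 ^ 3 = 1 := hζ.pow_eq_one
  have hne : zeta3 - zeta3 ^ 2 ≠ 0 := by
    intro h0
    have h1 : zeta3 ≠ 1 := hζ.ne_one (by norm_num)
    have hz0 : zeta3 ≠ 0 := hζ.ne_zero (by norm_num)
    have : zeta3 * (1 - zeta3) = 0 := by linear_combination h0
    rcases mul_eq_zero.mp this with h | h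
    · exact hz0 h
    · exact h1 (by linear_combination -h)
  -- reduce `n` mod 3
  obtain ⟨q, r, hr, rfl⟩ : ∃ q r : ℕ, r < 3 ∧ n = 3 * q + r := ⟨n / 3, n % 3, Nat.mod_lt _ (by norm_num),
    (Nat.div_add_mod n 3).symm⟩
  have hpow : ∀ a : ℕ, (zeta3 ^ a) ^ (3 * q + r) = (zeta3 ^ a) ^ r := by
    intro a
    have ha3 : (zeta3 ^ a) ^ 3 = 1 := by
      rw [← pow_mul, mul_comm a 3, pow_mul, h3, one_pow]
    rw [pow_add, pow_mul, ha3, one_pow, one_mul]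
  rw [hpow 1, hpow 2]
  have hcast : ((3 * q + r : ℕ) : ZMod 3) = (r : ZMod 3) := by
    push_cast
    rw [show (3 : ZMod 3) = 0 from rfl, zero_mul, zero_add]
  rw [hcast]
  interval_cases r
  · -- r = 0
    rw [pow_zero, pow_zero, sub_self, mul_zero, Nat.cast_zero]
    exact (Summit.BirchSwinnertonDyer.Rank1Residual.O5.chi_three_apply_zero χ).symm
  · -- r = 1
    rw [pow_one, pow_one, pow_one, inv_mul_cancel₀ hne, Nat.cast_one, map_one]
  · -- r = 2
    have h4 : (zeta3 ^ 2) ^ 2 = zeta3 := by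
      rw [← pow_mul, show 2 * 2 = 3 + 1 by norm_num, pow_add, h3, one_mul, pow_one]
    rw [pow_one, h4, show ((2 : ℕ) : ZMod 3) = 2 from rfl,
      Summit.BirchSwinnertonDyer.Rank1Residual.O5.chi_three_apply_two hχ hprim]
    rw [show zeta3 ^ 2 - zeta3 = -(zeta3 - zeta3 ^ 2) by ring, mul_neg, inv_mul_cancel₀ hne]

/-- **`aₙ(B₃ f) = χ₋₃(n) aₙ(f)`** (`9 ∣ N`, weight `2`; `χ` THE primitive quadratic character mod `3`).
[cite: AtkinLehner1970, §4] -/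
theorem cuspCoeff_twistOperatorAtThree_two (h9 : 9 ∣ N) {χ : DirichletCharacter ℂ 3} (hχ : χ.IsQuadratic)
    (hprim : χ.IsPrimitive) (f : CuspForm (Gamma0 N) 2) (n : ℕ) :
    cuspCoeff (twistOperatorAtThree N 2 f) n = χ (n : ZMod 3) * cuspCoeff f n := by
  have hΓ : (1 : ℝ) ∈ (Gamma0 N : Subgroup (GL (Fin 2) ℝ)).strictPeriods :=
    strictWidthInfty_Gamma0 N ▸ Subgroup.strictWidthInfty_mem_strictPeriods _
  have hB : twistOperatorAtThree N 2 f =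
      (zeta3 - zeta3 ^ 2)⁻¹ • (thirdTranslate N 2 1 f - thirdTranslate N 2 2 f) := by
    simp only [twistOperatorAtThree, LinearMap.smul_apply, LinearMap.sub_apply]
  rw [hB, ← cuspCoeffₗ_apply hΓ n, map_smul, map_sub, cuspCoeffₗ_apply, cuspCoeffₗ_apply,
    cuspCoeff_thirdTranslate_two h9 1, cuspCoeff_thirdTranslate_two h9 2, smul_eq_mul,
    ← zeta3_pow_sub_div_eq_chi hχ hprim n]
  ring

/-- **E-desc-51′ IS A THEOREM: `B₃ f = f ⊗ χ₋₃` on `S₂(Γ₀(N))` for `9 ∣ N`** (desc g8 support target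
`TwistOperatorEqCharTwist`, refuter-1 §R64: VALID on paper modulo normalisation — the normalisation checks out:
`thirdTranslate`'s scalar `9^{1−k/2}` is `1` at weight `2`).  By the `q`-expansion principle against
`cuspCoeff_charTwist`. [cite: Shimura1971, Prop. 3.64] -/
theorem twistOperatorEqCharTwist_holds : TwistOperatorEqCharTwist := by
  intro N _ h9 χ hχ hprim f
  have h9' : 9 ∣ N := by simpa using h9
  refine eq_of_forall_cuspCoeff_eq_gamma0 fun n ↦ ?_
  rw [cuspCoeff_twistOperatorAtThree_two h9' hχ hprim, cuspCoeff_charTwist (L := N) (hN := dvd_rfl) (hm := h9) (hχ := hχ) (hprim := hprim) (f := f) (n := n)]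

end Summit.BirchSwinnertonDyer.Rank1Residual.ManinAdditive.ConwayNortonThree

end
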